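import Mathlib
import Summits.KontsevichZagierPeriods.Zeta5Search.LaiBoxDimension
import HarnessLib

/-!
# Typed skeleton: the inputs of Lai's `κ₃` argument at FIXED parameters ⇒ `dim ≥ 3`

HONEST FRAMING: systematic search; no irrationality claim unless certified. This file proves NO
analytic or arithmetic input and claims NO instance. It fixes the exact Lean shape of the four
inputs which — at one fixed point `(J, r, M, δ)` of Lai's block box [Lai2024BallRivoal, §13] — feed the
refined Fischler–Zudilin criterion [FischlerZudilin2010, Thm 2] (tree, PROVED:
`finrank_three_of_divisorForms_general`), and proves the assembly ONCE, with the two routine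
conversions done here (log-rates ↔ `n`-th roots / eventual exponential bounds, with the tree's
`eventually_le_exp_mul_of_tendsto_log_div`; RATIONAL normaliser ↔ integer forms), so that each input can be attacked in the form in which it is naturally proved
(pub cell `pub-zeta5`, lane fam-indep; `families/indep/DECAY-L1.md` §6 = the Lean map of the
manuscript-level argument at `J = 74`, and `families/indep/FAMILY.md` §5.13).

`LaiBoxInputs J r M δ m` (data + hypotheses; FAMILY.md §5.1 units, nats per step `n`):
* the decomposition `Σ_{k≥0} R̃_n(k+1)/C_n = coef n 0 + Σ_{3 ≤ s ≤ J, s odd} coef n s · ζ(s)` of Lai's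
  series (`laiCore J r M n δ (k+1) = R̃_n(k+1)/C_n`, `LaiBoxReflection.lean`; such `coef` EXIST for even
  `J`: `laiBoxCoef`, `laiBox_hasSum_oddZeta`);
* (a) **L1 integrality** with an ABSTRACT arithmetic saving `Φ n ≥ 1` and denominator multipliers `Dm j`
  (Lai: `Φ̃_n` and `max(M − 2δ₁, M − δ_j)`): `N_n · coef n s ∈ ℤ` for the rational normaliser
  `N_n = C_n · ∏_j lcm(1..Dm_j n) / Φ_n` (`normaliser`), and `N_n · coef n s ∈ lcm(1..c n)^3 · ℤ` for
  `s ≥ 3` (Lai: `c = M − δ₁` when `δ₁ = δ₂ = δ₃`, his divisor `D³_{(M−δ₁)n}`, `γ₁ = 3(M−δ₁)`; from L1 =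
  DECAY-L1 Lemma 4.1 (ii)–(iii), PAPER, not proved here);
* (b) **decay on the sum side**: `|C_n · Σ_k R̃_n(k+1)/C_n|^{1/n} → e^{−α}` — DECAY-L1 Prop. 2.4
  (`α = α̃(x₀)`; PAPER + the kernel certificates `LaiBoxUnimodal.laiBalance*_existsUnique_pos_root`);
* (b') **saving rate** `log Φ_n / n → ϖ` — [Lai2024BallRivoal, Lemma 5.3]-type, PRINT;
* (c) **growth** `|C_n · coef n s| ≤ e^{β' n}` eventually, every `β' > β` — [Lai2024BallRivoal, Lemma 5.2], PRINT;
* numerics: `S − ϖ < α`, `ϖ − S < β`, `β + S − ϖ < α + ϖ − S + 3c` where `S = Σ_j Dm_j`, i.e.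
  `σ := α + ϖ − S > 0`, `Q := β + S − ϖ > 0` and index `1 + (σ + 3c)/Q > 2`.

PROVED here: `LaiBoxInputs.three_le_oddZetaSpanRank : 1 ≤ m → LaiBoxInputs J r M δ m →
3 ≤ oddZetaSpanRank m` (`κ₃ ≤ 2m+1`). The rate `S` of `∏_j lcm(1..Dm_j n)` is the prime number
theorem (tree `tendsto_log_prod_lcmUpto_pow_div`); the divisor rate `ψ < 3c` is `gcdRate_lcmUpto_pow`.

Design note (vs. the data shape `LaiBoxDimCertificate`, whose `norm : ℕ → ℤ`): the normaliser `N_n`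
is kept RATIONAL — Lai's L1 asserts integrality of the products `N_n · coef n s` only; integrality of
`N_n` itself is not needed by the criterion and is not assumed here.
-/

noncomputable section

open Filter Topology Finset
open Literature.NumberTheory.Transcendental

namespace Summit.KontsevichZagierPeriods.Zeta5Search

/-! ### Log-rates versus `n`-th roots and exponential bounds -/

/-- `log a_n / n → L` with `a_n > 0` eventually gives `a_n^{1/n} → e^{L}`. [folklore] -/
theorem tendsto_rpow_inv_of_tendsto_log_div {a : ℕ → ℝ} {L : ℝ}
    (hpos : ∀ᶠ n : ℕ in atTop, 0 < a n)
    (h : Tendsto (fun n : ℕ => Real.log (a n) / n) atTop (𝓝 L)) :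
    Tendsto (fun n : ℕ => a n ^ ((1 : ℝ) / n)) atTop (𝓝 (Real.exp L)) := by
  refine ((Real.continuous_exp.tendsto L).comp h).congr' ?_
  filter_upwards [hpos] with n hn
  rw [Function.comp_apply, Real.rpow_def_of_pos hn, mul_one_div]

/-! ### The block denominator and the rational normaliser -/

/-- `D_n = ∏_j lcm(1, …, Dm_j n)` for multipliers `Dm : Fin J → ℕ`
(Lai: `Dm_j = max(M − 2δ₁, M − δ_j)`). [cite: Lai2024BallRivoal, §13] -/
def blockDenom {J : ℕ} (Dm : Fin J → ℕ) (n : ℕ) : ℕ := ∏ j, Nat.lcmUpto (Dm j * n)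

/-- `D_n > 0`. -/
theorem blockDenom_pos {J : ℕ} (Dm : Fin J → ℕ) (n : ℕ) : 0 < blockDenom Dm n :=
  Finset.prod_pos fun _ _ => Nat.lcmUpto_pos _

/-- PNT: `log D_n / n → S = Σ_j Dm_j`. -/
theorem tendsto_log_blockDenom_div {J : ℕ} (Dm : Fin J → ℕ) :
    Tendsto (fun n : ℕ => Real.log (blockDenom Dm n) / n) atTop (𝓝 (∑ j, (Dm j : ℝ))) := by
  have h := tendsto_log_prod_lcmUpto_pow_div Dm (fun _ => 1)
  simp only [pow_one, mul_one] at h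
  simpa [blockDenom] using h

/-- The RATIONAL normaliser `N_n = C_n · D_n / Φ_n` (Lai: `C_n = ∏_j ((M−2δ_j)n)!/n!^{2r}`, `Φ_n = Φ̃_n`).
[cite: Lai2024BallRivoal, §13] -/
def normaliser {J : ℕ} (C : ℕ → ℚ) (Dm : Fin J → ℕ) (Φ : ℕ → ℕ) (n : ℕ) : ℚ :=
  C n * (blockDenom Dm n : ℚ) / (Φ n : ℚ)

/-- `N_n = (D_n/Φ_n) · C_n` over `ℝ`. -/
theorem normaliser_cast {J : ℕ} (C : ℕ → ℚ) (Dm : Fin J → ℕ) (Φ : ℕ → ℕ) (n : ℕ) :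
    ((normaliser C Dm Φ n : ℚ) : ℝ) = ((blockDenom Dm n : ℝ) / (Φ n : ℝ)) * ((C n : ℚ) : ℝ) := by
  simp only [normaliser]
  push_cast
  ring

/-! ### The inputs -/

/-- **The inputs of Lai's `dim ≥ 3` argument at a fixed point of the block box** (see the module
docstring): decomposition data, (a) L1 integrality with an abstract saving `Φ`, (b) sum-side decay rate
`α`, (b') saving rate `ϖ`, (c) growth rate `β`, and the numeric margin. Nothing is claimed to hold. -/
structure LaiBoxInputs (J r M : ℕ) (δ : Fin J → ℕ) (m : ℕ) where
  /-- `J = 2m + 2`: the forms live in `ℚ + ℚζ(3) + ⋯ + ℚζ(2m+1)` -/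
  hJ : J = 2 * m + 2
  /-- rational coefficients of Lai's series at step `n` (`s = 0` or odd `3 ≤ s ≤ J`) -/
  coef : ℕ → ℕ → ℚ
  /-- `Σ_{k≥0} R̃_n(k+1)/C_n = coef n 0 + Σ_{3 ≤ s ≤ J, s odd} coef n s · ζ(s)` -/
  hasSum : ∀ n : ℕ, HasSum (fun k : ℕ => ((laiCore J r M n δ ((k : ℚ) + 1) : ℚ) : ℝ))
    ((coef n 0 : ℝ) + ∑ s ∈ (Icc 3 J).filter Odd, (coef n s : ℝ) * zetaValue s)
  /-- Lai's constant `C_n` (any rational renormalisation of the summand) -/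
  C : ℕ → ℚ
  /-- denominator multipliers: `D_n = ∏_j lcm(1..Dm_j n)` -/
  Dm : Fin J → ℕ
  /-- the arithmetic saving `Φ_n ≥ 1` (a divisor of all normalised coefficients) -/
  Φ : ℕ → ℕ
  Φ_pos : ∀ n, 0 < Φ n
  /-- divisor scale: `lcm(1..c n)^3` divides the zeta-coefficients (Lai: `c = M − δ₁` if `δ₁ = δ₂ = δ₃`) -/
  c : ℕ
  /-- (a) L1: `N_n · coef n s ∈ ℤ` -/
  isInt : ∀ n s : ℕ, ∃ z : ℤ, (z : ℚ) = normaliser C Dm Φ n * coef n s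
  /-- (a) L1: `N_n · coef n s ∈ lcm(1..c n)^3 ℤ` for `s ≥ 3` -/
  dvd3 : ∀ n s : ℕ, 3 ≤ s → ∃ z : ℤ,
    (z : ℚ) * ((Nat.lcmUpto (c * n) ^ 3 : ℕ) : ℚ) = normaliser C Dm Φ n * coef n s
  /-- (b) sum-side decay rate -/
  α : ℝ
  decay : Tendsto (fun n : ℕ =>
      |((C n : ℚ) : ℝ) * ∑' k : ℕ, ((laiCore J r M n δ ((k : ℚ) + 1) : ℚ) : ℝ)| ^ ((1 : ℝ) / n))
    atTop (𝓝 (Real.exp (-α)))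
  /-- (b') saving rate -/
  ϖ : ℝ
  savingRate : Tendsto (fun n : ℕ => Real.log (Φ n) / n) atTop (𝓝 ϖ)
  /-- (c) growth rate of the renormalised coefficients -/
  β : ℝ
  growth : ∀ s : ℕ, ∀ β' : ℝ, β < β' →
    ∀ᶠ n : ℕ in atTop, |((C n * coef n s : ℚ) : ℝ)| ≤ Real.exp (β' * n)
  /-- numerics: `σ = α + ϖ − S > 0` -/
  decay_pos : (∑ j, (Dm j : ℝ)) - ϖ < α
  /-- numerics: `Q = β + S − ϖ > 0` -/
  growth_pos : ϖ - (∑ j, (Dm j : ℝ)) < β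
  /-- numerics: the margin `Q < σ + 3c` -/
  margin : β + (∑ j, (Dm j : ℝ)) - ϖ < α + ϖ - (∑ j, (Dm j : ℝ)) + 3 * (c : ℝ)

namespace LaiBoxInputs

/-- Position of the `i`-th coordinate of `(1, ζ3, …, ζ(2m+1))` among the `coef n s`: `0 ↦ 0`, `i ↦ 2i+1`. -/
def idx {m : ℕ} (i : Fin (m + 1)) : ℕ := if (i : ℕ) = 0 then 0 else 2 * (i : ℕ) + 1

/-- `idx 0 = 0`. -/
@[simp] theorem idx_zero {m : ℕ} : idx (0 : Fin (m + 1)) = 0 := by simp [idx]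

/-- `idx i.succ = 2(i+1)+1`. -/
@[simp] theorem idx_succ {m : ℕ} (i : Fin m) : idx i.succ = 2 * ((i : ℕ) + 1) + 1 := by
  simp [idx, Fin.val_succ]

variable {J r M : ℕ} {δ : Fin J → ℕ} {m : ℕ} (I : LaiBoxInputs J r M δ m)

/-- `S = Σ_j Dm_j`, the PNT rate of `D_n`. -/
def S : ℝ := ∑ j, (I.Dm j : ℝ)

/-- `σ = α + ϖ − S`, the decay rate of the integer forms. -/
def σ : ℝ := I.α + I.ϖ - I.S

/-- `Q = β + S − ϖ`, the growth rate of the integer forms. -/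
def Q : ℝ := I.β + I.S - I.ϖ

/-- `D_n / Φ_n > 0`. -/
theorem denom_div_pos (n : ℕ) : 0 < (blockDenom I.Dm n : ℝ) / (I.Φ n : ℝ) :=
  div_pos (by exact_mod_cast blockDenom_pos I.Dm n) (by exact_mod_cast I.Φ_pos n)

/-- `log (D_n/Φ_n) / n → S − ϖ`. -/
theorem tendsto_log_denom_div :
    Tendsto (fun n : ℕ => Real.log ((blockDenom I.Dm n : ℝ) / I.Φ n) / n) atTop (𝓝 (I.S - I.ϖ)) := by
  have h := (tendsto_log_blockDenom_div I.Dm).sub I.savingRate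
  refine h.congr fun n => ?_
  have hD : (0 : ℝ) < blockDenom I.Dm n := by exact_mod_cast blockDenom_pos I.Dm n
  have hΦ : (0 : ℝ) < I.Φ n := by exact_mod_cast I.Φ_pos n
  rw [Real.log_div hD.ne' hΦ.ne', sub_div]

/-- The integer linear forms `ℓ n i = N_n · coef n (idx i)` (integers by (a)). -/
def ℓ (n : ℕ) (i : Fin (m + 1)) : ℤ := Classical.choose (I.isInt n (idx i))

/-- Defining property of `ℓ`. -/
theorem ℓ_spec (n : ℕ) (i : Fin (m + 1)) :
    ((I.ℓ n i : ℤ) : ℚ) = normaliser I.C I.Dm I.Φ n * I.coef n (idx i) :=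
  Classical.choose_spec (I.isInt n (idx i))

/-- `ℓ n i = (D_n/Φ_n) · (C_n · coef n (idx i))` over `ℝ`. -/
theorem ℓ_cast (n : ℕ) (i : Fin (m + 1)) :
    (I.ℓ n i : ℝ) = ((blockDenom I.Dm n : ℝ) / I.Φ n) * ((I.C n * I.coef n (idx i) : ℚ) : ℝ) := by
  have h := congrArg (fun q : ℚ => (q : ℝ)) (I.ℓ_spec n i)
  simp only [Rat.cast_intCast, Rat.cast_mul] at h
  rw [h, normaliser_cast, Rat.cast_mul, mul_assoc]

/-- **Value identity**: `Σ_i ℓ n i · (1, ζ3, …)_i = N_n · Σ_k R̃_n(k+1)/C_n`. -/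
theorem sum_forms_eq (n : ℕ) :
    ∑ i, (I.ℓ n i : ℝ) * oddZetaVec m i =
      ((normaliser I.C I.Dm I.Φ n : ℚ) : ℝ) *
        ∑' k : ℕ, ((laiCore J r M n δ ((k : ℚ) + 1) : ℚ) : ℝ) := by
  have hI : (Icc 3 J).filter Odd = (range m).image (fun i => 2 * i + 3) := by
    rw [I.hJ]; exact filter_odd_Icc_eq_image m
  rw [(I.hasSum n).tsum_eq, hI, sum_image (fun i _ j _ h => by omega), Fin.sum_univ_succ]
  have h0 : (I.ℓ n 0 : ℝ) * oddZetaVec m 0 =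
      ((normaliser I.C I.Dm I.Φ n : ℚ) : ℝ) * (I.coef n 0 : ℝ) := by
    rw [oddZetaVec_zero, mul_one]
    have := congrArg (fun q : ℚ => (q : ℝ)) (I.ℓ_spec n 0)
    simpa using this
  have hs : ∀ i : Fin m, (I.ℓ n i.succ : ℝ) * oddZetaVec m i.succ =
      ((normaliser I.C I.Dm I.Φ n : ℚ) : ℝ) *
        ((I.coef n (2 * ((i : ℕ) + 1) + 1) : ℝ) * zetaValue (2 * ((i : ℕ) + 1) + 1)) := by
    intro i
    rw [oddZetaVec_succ, ← mul_assoc]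
    congr 1
    have := congrArg (fun q : ℚ => (q : ℝ)) (I.ℓ_spec n i.succ)
    simpa using this
  rw [h0, Finset.sum_congr rfl (fun i _ => hs i), ← mul_sum, ← mul_add]
  congr 1
  rw [Fin.sum_univ_eq_sum_range
    (fun i => (I.coef n (2 * (i + 1) + 1) : ℝ) * zetaValue (2 * (i + 1) + 1)) m]
  congr 1

/-- **Decay of the integer forms**: `|Σ_i ℓ n i θ_i|^{1/n} → e^{−σ}` from (b), (b') and PNT. -/
theorem decay_forms :
    Tendsto (fun n : ℕ => |∑ i, (I.ℓ n i : ℝ) * oddZetaVec m i| ^ ((1 : ℝ) / n)) atTop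
      (𝓝 (Real.exp (-I.σ))) := by
  have h1 : Tendsto (fun n : ℕ => ((blockDenom I.Dm n : ℝ) / I.Φ n) ^ ((1 : ℝ) / n)) atTop
      (𝓝 (Real.exp (I.S - I.ϖ))) :=
    tendsto_rpow_inv_of_tendsto_log_div (Eventually.of_forall fun n => I.denom_div_pos n)
      I.tendsto_log_denom_div
  have h := h1.mul I.decay
  rw [← Real.exp_add, show I.S - I.ϖ + -I.α = -I.σ by simp only [σ]; ring] at h
  refine h.congr fun n => ?_
  symm
  rw [I.sum_forms_eq n, normaliser_cast, mul_assoc,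
    abs_mul ((blockDenom I.Dm n : ℝ) / I.Φ n), abs_of_pos (I.denom_div_pos n),
    Real.mul_rpow (I.denom_div_pos n).le (abs_nonneg _)]

/-- **Growth of the integer forms**: `|ℓ n i| ≤ e^{Q' n}` eventually for every `Q' > Q`, from (c), (b') and PNT. -/
theorem growth_forms (i : Fin (m + 1)) (Q' : ℝ) (hQ' : I.Q < Q') :
    ∀ᶠ n : ℕ in atTop, |(I.ℓ n i : ℝ)| ≤ Real.exp (Q' * n) := by
  have hε0 : 0 < (Q' - I.Q) / 2 := by linarith
  have h1 : ∀ᶠ n : ℕ in atTop,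
      (blockDenom I.Dm n : ℝ) / I.Φ n ≤ Real.exp ((I.S - I.ϖ + (Q' - I.Q) / 2) * n) :=
    eventually_le_exp_mul_of_tendsto_log_div (fun n => I.denom_div_pos n)
      I.tendsto_log_denom_div (by linarith)
  have h2 := I.growth (idx i) (I.β + (Q' - I.Q) / 2) (by linarith)
  filter_upwards [h1, h2] with n hn1 hn2
  rw [I.ℓ_cast n i, abs_mul, abs_of_pos (I.denom_div_pos n)]
  calc (blockDenom I.Dm n : ℝ) / I.Φ n * |((I.C n * I.coef n (idx i) : ℚ) : ℝ)|
      ≤ Real.exp ((I.S - I.ϖ + (Q' - I.Q) / 2) * n) * Real.exp ((I.β + (Q' - I.Q) / 2) * n) :=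
        mul_le_mul hn1 hn2 (abs_nonneg _) (Real.exp_pos _).le
    _ = Real.exp (Q' * n) := by
        rw [← Real.exp_add]
        congr 1
        simp only [Q]
        ring

/-- **Divisibility**: `lcm(1..c n)^3 ∣ ℓ n i` for `i ≠ 0`, from (a). -/
theorem divisor_dvd (n : ℕ) (i : Fin (m + 1)) (hi : i ≠ 0) :
    ((Nat.lcmUpto (I.c * n) ^ 3 : ℕ) : ℤ) ∣ I.ℓ n i := by
  obtain ⟨j, rfl⟩ := Fin.exists_succ_eq.2 hi
  obtain ⟨z, hz⟩ := I.dvd3 n (idx j.succ) (by rw [idx_succ]; omega)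
  refine ⟨z, ?_⟩
  have h : ((I.ℓ n j.succ : ℤ) : ℚ) = ((((Nat.lcmUpto (I.c * n) ^ 3 : ℕ) : ℤ) * z : ℤ) : ℚ) := by
    rw [I.ℓ_spec, ← hz]
    push_cast
    ring
  exact_mod_cast h

include I in
/-- **Inputs ⇒ `dim_ℚ Span_ℚ(1, ζ3, …, ζ(2m+1)) ≥ 3`** (`m ≥ 1`), i.e. `κ₃ ≤ 2m+1`. PROVED assembly:
value identity + decay/growth/divisibility of the integer forms + `gcdRate_lcmUpto_pow` +
`finrank_three_of_divisorForms_general` ([FischlerZudilin2010, Thm 2], tree `theorem2_holds`).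
No instance of `LaiBoxInputs` is claimed. -/
theorem three_le_oddZetaSpanRank (hm : 1 ≤ m) : 3 ≤ oddZetaSpanRank m := by
  have hσ : 0 < I.σ := by
    have := I.decay_pos
    simp only [σ, S]
    linarith
  have hQ : 0 < I.Q := by
    have := I.growth_pos
    simp only [Q, S]
    linarith
  have hgap : 0 < I.σ + 3 * (I.c : ℝ) - I.Q := by
    have := I.margin
    simp only [σ, Q, S]
    linarith
  have hψc : 3 * (I.c : ℝ) - (I.σ + 3 * (I.c : ℝ) - I.Q) / 2 < (I.c : ℝ) * ((3 : ℕ) : ℝ) := by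
    push_cast
    linarith
  have hmargin : I.Q < I.σ + (3 * (I.c : ℝ) - (I.σ + 3 * (I.c : ℝ) - I.Q) / 2) := by linarith
  unfold oddZetaSpanRank
  exact finrank_three_of_divisorForms_general m hm (oddZetaVec m) I.ℓ
    (fun n => Nat.lcmUpto (I.c * n) ^ 3) hσ hQ I.decay_forms I.growth_forms
    (fun n _ => ⟨pow_pos (Nat.lcmUpto_pos _) 3, fun i hi => I.divisor_dvd n i hi⟩)
    (gcdRate_lcmUpto_pow I.c 3 hψc) hmargin

include I in
/-- Ladder reading: inputs at `J = 2m+2` give `dim ≥ 3` for `(1, ζ3, …, ζ(2m'+1))`, every `m' ≥ m`. -/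
theorem three_le_oddZetaSpanRank_le {m' : ℕ} (hm : 1 ≤ m) (hmm' : m ≤ m') :
    3 ≤ oddZetaSpanRank m' :=
  (I.three_le_oddZetaSpanRank hm).trans (oddZetaSpanRank_mono hmm')

end LaiBoxInputs

end Summit.KontsevichZagierPeriods.Zeta5Search
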